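import Summits.CriticalPhenomena.PercolationContinuityZ3.Theorems.Transplant.CayleyMilnorTransitive
import HarnessLib

/-!
# Milnor's kernel lemma, VI: the SCREW/GLIDE CRITERION on `ℤ³` — a graph invariant under the horizontal translations and ONE affine step
# `x ↦ (M x̄, x₂ + 1)` whose linear part `M ∈ GL₂(ℤ)` has eigenvalue `1` has `θ_v(p_c) = 0` (modulo the one-type scaled node ALONE)

builds on p205010 (kernel theorem, internal audit signed; external expert review pending) — nothing in this file uses p205010.  Every
percolation theorem here is CONDITIONAL on the OPEN node `SamePDropOfSkeletonFrmScaled₁` (hypothesis `hN`; nothing is claimed about it) and on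
NOTHING ELSE.  Lane `prim-bschramm`, seat `prim-bschramm-p4` gen 18 (PART C3 of `P4-GENERAL.md` §40).  Helper file
(`--supports stmt-CriticalPhenomena-4575`).

THE CRITERION (`Glide3.criticalContinuity`).  `G` a connected locally finite graph on `Site 3 = ℤ³`, read as layers `x₂ = const` over the plane
`x̄ = (x₀, x₁)`, invariant under every horizontal translation `x ↦ x + (u, 0)` and under ONE affine step `glide M : x ↦ (M x̄, x₂ + 1)` with
`M : ℤ² ≃+ ℤ²`.  Then the group `ℤ² ⋊_M ℤ` (Mathlib `SemidirectProduct`, `ℤ` acting on `ℤ²` through the powers of `M`) acts on `ℤ³` by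
`(u, k) • x = (M^k x̄ + u, x₂ + k)`: by graph automorphisms, transitively, FREELY.  If `M` has eigenvalue `1` — an additive `ℓ : ℤ² → ℤ` with
`ℓ ∘ M = ℓ` and `ℓ ≢ 0` — then `(u, k) ↦ (ℓ u, k)` is a homomorphism `ℤ² ⋊_M ℤ → ℤ²` of rank-2 image (`b₁ ≥ 2`), and the chart-free theorem
`AutScaled.criticalContinuity` (file IV) gives `θ_v(p_c(G)) = 0` at every vertex, modulo the scaled node.  Glide reflections (`M` an involution
fixing a line) qualify; screw ROTATIONS of order `≥ 2` do not (`M − 1` invertible over `ℚ`: `b₁(ℤ² ⋊_M ℤ) = 1`, the multi-type wall of §39.4).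
THE FIRST CUSTOMER is the hexagonal close packing through its `c`-glide `(a, b, z) ↦ (−b, −a, z + 1)` (file `CayleyMilnorGlideHcp`:
`SamePDropOfSkeletonFrmScaled₁ → HcpOwnCriticalContinuity`, TARGET 2t of the lane's class map, previously outside every typed node).  Which crystal
nets qualify (R-level, P4-GENERAL §40): a net whose vertices form at most TWO classes under its translation lattice, exchanged (if two) by a glide
reflection or a mirror — the point group of the transitive subgroup is then `{1, σ}` with `σ` a reflection, whose invariant plane gives `b₁ = 2`;
nets needing a rotation or screw of order `≥ 2` to exchange their classes have `b₁ ≤ 1` for every transitive crystallographic subgroup.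
[cite: BenjaminiSchramm1996, Conj. 4; §2 (almost transitive graphs)] [cite: MilnorSolvableGrowth1968, Lemma 1] [cite: Hutchcroft2016, Thm. 1.1]
-/

noncomputable section

namespace Summit.CriticalPhenomena.PercolationContinuityZ3.Theorems.Transplant

open SimpleGraph Literature.Probability.LatticeModels Literature.Probability.Percolation
open scoped Classical

namespace Glide3

/-! ## §1 Layer coordinates on `ℤ³` -/

/-- The planar part `x̄ = (x₀, x₁)` of a site of `ℤ³`. [folklore] -/
def pl (x : Site 3) : Site 2 := ![x 0, x 1]

/-- The site of `ℤ³` with planar part `y` and height `z`. [folklore] -/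
def mk (y : Site 2) (z : ℤ) : Site 3 := ![y 0, y 1, z]

/-- `(mk y z)₀ = y₀`. [folklore] -/
@[simp] theorem mk_apply_zero (y : Site 2) (z : ℤ) : mk y z 0 = y 0 := rfl

/-- `(mk y z)₁ = y₁`. [folklore] -/
@[simp] theorem mk_apply_one (y : Site 2) (z : ℤ) : mk y z 1 = y 1 := rfl

/-- `(mk y z)₂ = z`. [folklore] -/
@[simp] theorem mk_apply_two (y : Site 2) (z : ℤ) : mk y z 2 = z := rfl

/-- `pl (mk y z) = y`. [folklore] -/
@[simp] theorem pl_mk (y : Site 2) (z : ℤ) : pl (mk y z) = y := by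
  ext i; fin_cases i <;> rfl

/-- `(pl x)₀ = x₀`. [folklore] -/
@[simp] theorem pl_apply_zero (x : Site 3) : pl x 0 = x 0 := rfl

/-- `(pl x)₁ = x₁`. [folklore] -/
@[simp] theorem pl_apply_one (x : Site 3) : pl x 1 = x 1 := rfl

/-- A site is determined by its planar part and its height. [folklore] -/
theorem mk_pl (x : Site 3) : mk (pl x) (x 2) = x := by
  ext i; fin_cases i <;> rfl

/-- `mk` is additive. [folklore] -/
theorem mk_add (y y' : Site 2) (z z' : ℤ) : mk y z + mk y' z' = mk (y + y') (z + z') := by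
  ext i; fin_cases i <;> rfl

/-- `mk` is injective in both arguments. [folklore] -/
theorem mk_eq_mk_iff {y y' : Site 2} {z z' : ℤ} : mk y z = mk y' z' ↔ y = y' ∧ z = z' := by
  constructor
  · intro h
    refine ⟨?_, by simpa using congrFun h 2⟩
    have := congrArg pl h
    rwa [pl_mk, pl_mk] at this
  · rintro ⟨rfl, rfl⟩; rfl

/-- `mk 0 0 = 0`. [folklore] -/
@[simp] theorem mk_zero_zero : mk 0 0 = 0 := by
  ext i; fin_cases i <;> rfl

/-- `pl 0 = 0`. [folklore] -/
@[simp] theorem pl_zero : pl 0 = 0 := by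
  ext i; fin_cases i <;> rfl

/-! ## §2 The powers of `M` and the glide group `ℤ² ⋊_M ℤ` -/

variable (M : Site 2 ≃+ Site 2)

/-- `M` as an automorphism of `Multiplicative ℤ²`. [folklore] -/
def mulM : MulAut (Multiplicative (Site 2)) := AddEquiv.toMultiplicative M

/-- `mulM M` is `M` in multiplicative notation. [folklore] -/
@[simp] theorem toAdd_mulM (v : Multiplicative (Site 2)) : (mulM M v).toAdd = M v.toAdd := rfl

/-- **The action of `ℤ` on `ℤ²` through the powers of `M`** (the structure map of the semidirect product). [folklore] -/
def rot : Multiplicative ℤ →* MulAut (Multiplicative (Site 2)) := zpowersHom _ (mulM M)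

/-- `M^k` as a function `ℤ² → ℤ²` (`k ∈ ℤ`). [folklore] -/
def Mz (k : ℤ) (v : Site 2) : Site 2 := (rot M (Multiplicative.ofAdd k) (Multiplicative.ofAdd v)).toAdd

/-- `rot` computes `Mz` (multiplicative form). [folklore] -/
theorem toAdd_rot (k : Multiplicative ℤ) (v : Multiplicative (Site 2)) : (rot M k v).toAdd = Mz M k.toAdd v.toAdd := rfl

/-- `M^k` is additive. [folklore] -/
theorem Mz_add (k : ℤ) (v w : Site 2) : Mz M k (v + w) = Mz M k v + Mz M k w := by
  unfold Mz
  rw [ofAdd_add, map_mul, toAdd_mul]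

/-- `M^k 0 = 0`. [folklore] -/
@[simp] theorem Mz_zero (k : ℤ) : Mz M k 0 = 0 := by
  unfold Mz
  rw [ofAdd_zero, map_one, toAdd_one]

/-- `M^0 = id`. [folklore] -/
@[simp] theorem Mz_zero_pow (v : Site 2) : Mz M 0 v = v := by
  unfold Mz
  rw [ofAdd_zero, map_one, MulAut.one_apply, toAdd_ofAdd]

/-- `M^{j+k} = M^j ∘ M^k`. [folklore] -/
theorem Mz_add_pow (j k : ℤ) (v : Site 2) : Mz M (j + k) v = Mz M j (Mz M k v) := by
  unfold Mz
  rw [ofAdd_add, map_mul, MulAut.mul_apply, ofAdd_toAdd]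

/-- `M^1 = M`. [folklore] -/
@[simp] theorem Mz_one (v : Site 2) : Mz M 1 v = M v := by
  unfold Mz rot
  rw [zpowersHom_apply, toAdd_ofAdd, zpow_one, toAdd_mulM, toAdd_ofAdd]

/-- An `M`-invariant additive functional is invariant under every power `M^k`, `k ∈ ℤ`. [folklore] -/
theorem apply_Mz_of_invariant (ℓ : Site 2 →+ ℤ) (hℓ : ∀ v, ℓ (M v) = ℓ v) (k : ℤ) (v : Site 2) : ℓ (Mz M k v) = ℓ v := by
  induction k using Int.induction_on generalizing v with
  | zero => rw [Mz_zero_pow]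
  | succ k ih => rw [Mz_add_pow, ih, Mz_one, hℓ]
  | pred k ih =>
    -- `ℓ (M^{-k-1} v) = ℓ (M (M^{-k-1} v)) = ℓ (M^{-k} v) = ℓ v`
    calc ℓ (Mz M (-(k : ℤ) - 1) v) = ℓ (M (Mz M (-(k : ℤ) - 1) v)) := (hℓ _).symm
      _ = ℓ (Mz M (1 + (-(k : ℤ) - 1)) v) := by rw [Mz_add_pow, Mz_one]
      _ = ℓ (Mz M (-(k : ℤ)) v) := by rw [show (1 : ℤ) + (-(k : ℤ) - 1) = -(k : ℤ) by ring]
      _ = ℓ v := ih v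

/-- **The glide group** `ℤ² ⋊_M ℤ`. [folklore] -/
abbrev Grp : Type := Multiplicative (Site 2) ⋊[rot M] Multiplicative ℤ

/-- The translation part `u ∈ ℤ²` of `(u, k)`. [folklore] -/
def tr (a : Grp M) : Site 2 := a.left.toAdd

/-- The height shift `k ∈ ℤ` of `(u, k)`. [folklore] -/
def ht (a : Grp M) : ℤ := a.right.toAdd

/-- The element `(u, k)` of the glide group. [folklore] -/
def elt (u : Site 2) (k : ℤ) : Grp M := ⟨Multiplicative.ofAdd u, Multiplicative.ofAdd k⟩

/-- `tr (u, k) = u`. [folklore] -/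
@[simp] theorem tr_elt (u : Site 2) (k : ℤ) : tr M (elt M u k) = u := rfl

/-- `ht (u, k) = k`. [folklore] -/
@[simp] theorem ht_elt (u : Site 2) (k : ℤ) : ht M (elt M u k) = k := rfl

/-- `tr 1 = 0`. [folklore] -/
@[simp] theorem tr_one : tr M 1 = 0 := rfl

/-- `ht 1 = 0`. [folklore] -/
@[simp] theorem ht_one : ht M 1 = 0 := rfl

/-- Translation part of a product: `u + M^k u'`. [folklore] -/
theorem tr_mul (a b : Grp M) : tr M (a * b) = tr M a + Mz M (ht M a) (tr M b) := by
  show (a.left * rot M a.right b.left).toAdd = _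
  rw [toAdd_mul, toAdd_rot]; rfl

/-- Height part of a product: `k + k'`. [folklore] -/
theorem ht_mul (a b : Grp M) : ht M (a * b) = ht M a + ht M b := by
  show (a.right * b.right).toAdd = _
  rw [toAdd_mul]; rfl

/-- An element is determined by its translation part and its height. [folklore] -/
theorem eq_elt (a : Grp M) : a = elt M (tr M a) (ht M a) := by
  cases a; rfl

/-! ## §3 The affine action `(u, k) • x = (M^k x̄ + u, x₂ + k)` on `ℤ³` -/

/-- **The action of the glide group on `ℤ³`.** [folklore] -/
instance action : MulAction (Grp M) (Site 3) where
  smul a x := mk (Mz M (ht M a) (pl x) + tr M a) (x 2 + ht M a)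
  one_smul x := by
    show mk (Mz M (ht M 1) (pl x) + tr M 1) (x 2 + ht M 1) = x
    rw [ht_one, tr_one, Mz_zero_pow, add_zero, add_zero, mk_pl]
  mul_smul a b x := by
    show mk (Mz M (ht M (a * b)) (pl x) + tr M (a * b)) (x 2 + ht M (a * b)) =
      mk (Mz M (ht M a) (pl (mk (Mz M (ht M b) (pl x) + tr M b) (x 2 + ht M b))) + tr M a)
        ((mk (Mz M (ht M b) (pl x) + tr M b) (x 2 + ht M b)) 2 + ht M a)
    rw [pl_mk, mk_apply_two, ht_mul, tr_mul, Mz_add_pow, Mz_add]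
    congr 1
    · abel
    · ring

/-- The action, unfolded. [folklore] -/
theorem smul_def (a : Grp M) (x : Site 3) : a • x = mk (Mz M (ht M a) (pl x) + tr M a) (x 2 + ht M a) := rfl

/-- `(u, k) • 0 = (u, k)`. [folklore] -/
theorem elt_smul_zero (u : Site 2) (k : ℤ) : elt M u k • (0 : Site 3) = mk u k := by
  rw [smul_def, pl_zero, Mz_zero, zero_add, tr_elt, ht_elt]
  show mk u (0 + k) = mk u k
  rw [zero_add]

/-- **The action is transitive** (indeed `(x̄, x₂) • 0 = x`). [folklore] -/
theorem smul_transitive (x : Site 3) : ∃ a : Grp M, a • (0 : Site 3) = x :=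
  ⟨elt M (pl x) (x 2), by rw [elt_smul_zero, mk_pl]⟩

/-- **The action is free**: the stabiliser of `0` is trivial. [folklore] -/
theorem stabilizer_eq_bot : MulAction.stabilizer (Grp M) (0 : Site 3) = ⊥ := by
  refine (Subgroup.eq_bot_iff_forall _).2 fun a ha => ?_
  rw [MulAction.mem_stabilizer_iff, eq_elt M a, elt_smul_zero, ← mk_zero_zero, mk_eq_mk_iff] at ha
  rw [eq_elt M a, ha.1, ha.2]; rfl

/-- The stabiliser of `0` is finite. [folklore] -/
theorem stabilizer_finite : (MulAction.stabilizer (Grp M) (0 : Site 3) : Set (Grp M)).Finite := by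
  rw [stabilizer_eq_bot]; exact Set.finite_singleton 1

/-- **The affine step** `glide M : x ↦ (M x̄, x₂ + 1)` (the generator `(0, 1)`; a glide reflection when `M` is a reflection, a screw when `M` is
a rotation). [folklore] -/
def glide (x : Site 3) : Site 3 := mk (M (pl x)) (x 2 + 1)

/-- `(0, 1) • x = glide M x`. [folklore] -/
theorem elt_zero_one_smul (x : Site 3) : elt M 0 1 • x = glide M x := by
  rw [smul_def, ht_elt, tr_elt, Mz_one, add_zero]; rfl

/-- `(u, 0) • x = x + (u, 0)`. [folklore] -/
theorem elt_zero_smul (u : Site 2) (x : Site 3) : elt M u 0 • x = x + mk u 0 := by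
  rw [smul_def, ht_elt, tr_elt, Mz_zero_pow, add_zero]
  conv_rhs => rw [← mk_pl x, mk_add, add_zero]

/-- **Action by automorphisms from the two generators**: if the horizontal translations and the affine step preserve adjacency, so does every
element of the glide group (`(u, k) = (u, 0) · (0, 1)^k`). [folklore] -/
theorem isActionByAut (G : SimpleGraph (Site 3)) (htr : ∀ (u : Site 2) (x y : Site 3), G.Adj (x + mk u 0) (y + mk u 0) ↔ G.Adj x y)
    (hgl : ∀ x y : Site 3, G.Adj (glide M x) (glide M y) ↔ G.Adj x y) : IsActionByAut G (Grp M) := by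
  -- the elements acting by automorphisms form a subgroup
  let H : Subgroup (Grp M) :=
    { carrier := {a | ∀ x y : Site 3, G.Adj (a • x) (a • y) ↔ G.Adj x y}
      mul_mem' := fun {a b} ha hb x y => by rw [mul_smul, mul_smul, ha, hb]
      one_mem' := fun x y => by rw [one_smul, one_smul]
      inv_mem' := fun {a} ha x y => by rw [← ha (a⁻¹ • x) (a⁻¹ • y), smul_inv_smul, smul_inv_smul] }
  have hg : elt M 0 1 ∈ H := fun x y => by
    show G.Adj (elt M 0 1 • x) (elt M 0 1 • y) ↔ G.Adj x y
    rw [elt_zero_one_smul, elt_zero_one_smul, hgl]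
  have hu : ∀ u, elt M u 0 ∈ H := fun u x y => by
    show G.Adj (elt M u 0 • x) (elt M u 0 • y) ↔ G.Adj x y
    rw [elt_zero_smul, elt_zero_smul, htr]
  have hk : ∀ k : ℤ, elt M 0 k ∈ H := fun k => by
    have e : elt M 0 k = (elt M 0 1) ^ k := by
      have : (SemidirectProduct.inr (Multiplicative.ofAdd k) : Grp M) = SemidirectProduct.inr (Multiplicative.ofAdd (1 : ℤ)) ^ k := by
        rw [← map_zpow, ← Int.ofAdd_mul, one_mul]
      exact this
    rw [e]; exact H.zpow_mem hg k
  intro a x y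
  have ha : a ∈ H := by
    have e : a = elt M (tr M a) 0 * elt M 0 (ht M a) := (SemidirectProduct.inl_left_mul_inr_right a).symm
    rw [e]; exact H.mul_mem (hu _) (hk _)
  exact ha x y

/-! ## §4 The rank-2 character `(u, k) ↦ (ℓ u, k)` and the theorem -/

/-- The functional part of the character, `u ↦ (ℓ u, 0)`, multiplicatively. [folklore] -/
def chiN (ℓ : Site 2 →+ ℤ) : Multiplicative (Site 2) →* Multiplicative (Site 2) :=
  AddMonoidHom.toMultiplicative
    { toFun := fun u => (Pi.single (0 : Fin 2) (ℓ u) : Site 2), map_zero' := by rw [map_zero, Pi.single_zero],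
      map_add' := fun u v => by rw [map_add, Pi.single_add] }

/-- The height part of the character, `k ↦ (0, k)`, multiplicatively. [folklore] -/
def chiG : Multiplicative ℤ →* Multiplicative (Site 2) :=
  AddMonoidHom.toMultiplicative
    { toFun := fun k => (Pi.single (1 : Fin 2) k : Site 2), map_zero' := by rw [Pi.single_zero],
      map_add' := fun u v => by rw [Pi.single_add] }

/-- **The character** `χ : ℤ² ⋊_M ℤ → ℤ²`, `(u, k) ↦ (ℓ u, k)` — a homomorphism because `ℓ ∘ M = ℓ`. [folklore] -/
def chi (ℓ : Site 2 →+ ℤ) (hℓ : ∀ v, ℓ (M v) = ℓ v) : Grp M →* Multiplicative (Site 2) :=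
  SemidirectProduct.lift (chiN ℓ) chiG fun g => MonoidHom.ext fun v => by
    -- the target is commutative, so conjugation is trivial; `ℓ` is `M^k`-invariant
    show chiN ℓ (rot M g v) = chiG g * chiN ℓ v * (chiG g)⁻¹
    rw [mul_inv_cancel_comm]
    show Multiplicative.ofAdd (Pi.single (0 : Fin 2) (ℓ (rot M g v).toAdd) : Site 2) =
      Multiplicative.ofAdd (Pi.single (0 : Fin 2) (ℓ v.toAdd) : Site 2)
    rw [toAdd_rot, apply_Mz_of_invariant M ℓ hℓ]

/-- Value of the character on `(u, k)`. [folklore] -/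
theorem toAdd_chi_elt (ℓ : Site 2 →+ ℤ) (hℓ : ∀ v, ℓ (M v) = ℓ v) (u : Site 2) (k : ℤ) :
    (chi M ℓ hℓ (elt M u k)).toAdd = ![ℓ u, k] := by
  show (chiN ℓ (Multiplicative.ofAdd u) * chiG (Multiplicative.ofAdd k)).toAdd = _
  rw [toAdd_mul]
  show (Pi.single (0 : Fin 2) (ℓ u) : Site 2) + (Pi.single (1 : Fin 2) k : Site 2) = _
  ext i; fin_cases i <;> simp

/-- **The character has rank-2 image** as soon as `ℓ ≢ 0`: `det((ℓ u₀, 0), (0, 1)) = ℓ u₀`. [folklore] -/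
theorem chi_rank (ℓ : Site 2 →+ ℤ) (hℓ : ∀ v, ℓ (M v) = ℓ v) (u₀ : Site 2) (hu₀ : ℓ u₀ ≠ 0) :
    ∃ a b : Grp M, MaxArea.det2 (chi M ℓ hℓ a).toAdd (chi M ℓ hℓ b).toAdd ≠ 0 := by
  refine ⟨elt M u₀ 0, elt M 0 1, ?_⟩
  rw [toAdd_chi_elt, toAdd_chi_elt, MaxArea.det2, map_zero]
  simpa using hu₀

/-- **THEOREM (the screw/glide criterion, modulo the scaled node ALONE).**  A connected locally finite graph on `ℤ³` invariant under the
horizontal translations `x ↦ x + (u, 0)` and under the affine step `x ↦ (M x̄, x₂ + 1)`, where `M : ℤ² ≃+ ℤ²` fixes a nonzero additive functional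
`ℓ` (`ℓ ∘ M = ℓ`, i.e. `M` has eigenvalue `1`), has `θ_v(p_c) = 0` at every vertex: the glide group `ℤ² ⋊_M ℤ` acts freely and transitively by
automorphisms with the rank-2 character `(u, k) ↦ (ℓ u, k)`, and `AutScaled.criticalContinuity` applies.
[cite: BenjaminiSchramm1996, Conj. 4; §2] [cite: MilnorSolvableGrowth1968, Lemma 1] [cite: Hutchcroft2016, Thm. 1.1] -/
theorem criticalContinuity (hN : SamePDropOfSkeletonFrmScaled₁) (G : SimpleGraph (Site 3)) [G.LocallyFinite] (hc : G.Connected)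
    (htr : ∀ (u : Site 2) (x y : Site 3), G.Adj (x + mk u 0) (y + mk u 0) ↔ G.Adj x y)
    (hgl : ∀ x y : Site 3, G.Adj (glide M x) (glide M y) ↔ G.Adj x y)
    (ℓ : Site 2 →+ ℤ) (hℓ : ∀ v, ℓ (M v) = ℓ v) (u₀ : Site 2) (hu₀ : ℓ u₀ ≠ 0) (v : Site 3) :
    theta G v (criticalProbIOf G v) = 0 :=
  AutScaled.criticalContinuity hN (isActionByAut M G htr hgl) hc 0 (smul_transitive M) (stabilizer_finite M) (chi M ℓ hℓ)
    (chi_rank M ℓ hℓ u₀ hu₀) v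

/-- … and `θ_v(p) = 0` for every `p ≤ p_c`. [cite: BenjaminiSchramm1996, Conj. 4; §2] -/
theorem theta_eq_zero_of_le (hN : SamePDropOfSkeletonFrmScaled₁) (G : SimpleGraph (Site 3)) [G.LocallyFinite] (hc : G.Connected)
    (htr : ∀ (u : Site 2) (x y : Site 3), G.Adj (x + mk u 0) (y + mk u 0) ↔ G.Adj x y)
    (hgl : ∀ x y : Site 3, G.Adj (glide M x) (glide M y) ↔ G.Adj x y)
    (ℓ : Site 2 →+ ℤ) (hℓ : ∀ v, ℓ (M v) = ℓ v) (u₀ : Site 2) (hu₀ : ℓ u₀ ≠ 0) (v : Site 3) {p : unitInterval}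
    (hp : (p : ℝ) ≤ criticalProb G v) : theta G v p = 0 :=
  AutScaled.theta_eq_zero_of_le hN (isActionByAut M G htr hgl) hc 0 (smul_transitive M) (stabilizer_finite M) (chi M ℓ hℓ)
    (chi_rank M ℓ hℓ u₀ hu₀) v hp

end Glide3

end Summit.CriticalPhenomena.PercolationContinuityZ3.Theorems.Transplant

end
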